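import Summits.CriticalPhenomena.PercolationContinuityZ3.Theorems.PercNearOneGluingNoHeavyLowerTailThreePartitionGridTransport
import HarnessLib.Audit

/-!
# `NoHeavyLowerTail` (crux stmt-CriticalPhenomena-4575), master-family hierarchy P3 (gen 34): the TOKEN form of the grid-transport
# conjecture — a monotone token matching proves `GridTransport` — and the TYPED FIBRE-LOCAL matching conjecture `TypedGridMatching`

Support file (seat `prim-masterthm-p3`; `--supports stmt-CriticalPhenomena-4575`; memo
`run/shared/lean/prim/prim-masterthm/FROM-prim-masterthm-p3-g34-FIBRE-LOCAL-CERTIFICATE.md`, HIERARCHY §41).  Companion of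
`…ThreePartitionGridTransport` (`gtKernel`, `GridTransport` ⟹ `ThreePartitionPositivityTwisted` ≡ COMB-C3 ⟹ Sahi's `C₃` for product measures).

TOKENS (this work).  The kernel `κ_{τ,𝒱,𝒲}(q) = 2[x₁∈𝒱𝒲] + [x₂∈𝒱][x₃∈𝒲] − [x₁∈𝒱][x₃∈𝒲] − [x₁∈𝒲][x₂∈𝒱] − [x₂∈𝒱𝒲]` is, pointwise, the number of
POSITIVE tokens at `q` (two "units" `a`, `b` at `{x₁ ∈ 𝒱∩𝒲}`, one at `{x₂∈𝒱, x₃∈𝒲}`) minus the number of NEGATIVE tokens at `q`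
(`N1 = {x₁∈𝒱, x₃∈𝒲}`, `N2 = {x₁∈𝒲, x₂∈𝒱}`, `N3 = {x₂∈𝒱∩𝒲}`) (`gtKernel_eq_tokens`, `sum_gtKernel_eq_card_sub_card`).  Hence ANY map sending
the negative tokens injectively to positive tokens at larger configurations (grid order "copy 1 grows, copy 2 shrinks") proves
`∑_{q∈𝒰} κ ≥ 0` for every family `𝒰` closed upwards (`sum_gtKernel_nonneg_of_gtMatchable`; the easy direction of Hall's theorem), and a
matching for every instance proves `GridTransport` (`gridTransport_of_gtMatchable`).
THE TYPED FIBRE-LOCAL MATCHING (this work, conjecture `TypedGridMatching`, OPEN): the matching can be chosen so that every token except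
`N1` stays inside one CUBE FIBRE — an `N2` token uses unit `b` of a configuration with the SAME copy 3, an `N3` token uses unit `a` of a
configuration with the same copy 3 or the positive token `{x₂∈𝒱,x₃∈𝒲}` of a configuration with the same copy 1, and an `N1` token uses
unit `a` of a configuration with the same copy 2 (a pure "merge part of copy 3 into copy 1" move) or unit `b` of a configuration whose copy 3
is contained in its own.  EVIDENCE (not kernel facts; seat code `gttyped*.c`): feasible for ALL `(τ,𝒱,𝒲)` on `≤ 3` points (`2 888`
nontrivial instances, all `τ`), for `4.7·10⁴` random instances on `4` points and `3·10³` on `5` points (the untyped fibre-local form: all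
`446 224` instances on `4` points, `2.3·10⁴` samples on `5`) — `0` failures; every further restriction tested fails (memo §5b).  Its rank form is a family of plain CUBE incidence statements
(memo §6), the world of `…TwoPartitionCoreProof`.  `gtMatchable_of_typedMatchable`, `gridTransport_of_typedGridMatching`.
HONEST LABEL: two identities and the easy direction of Hall (proved); a conjecture (open) with its one-line consequences; COMB-C3 / Sahi's
`C₃` remain OPEN; nothing here bears on the crux. [this work]
-/

noncomputable section

open Finset
open scoped symmDiff Classical

namespace Summit.CriticalPhenomena.PercolationContinuityZ3.Theorems.ThreePartition

variable {ι : Type*} [Fintype ι]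

/-! ## The grid order and the tokens -/

/-- The grid order on configurations: copy 1 grows and copy 2 shrinks (`…GridTransport`). [this work] -/
def gle (τ : Set ι) (q q' : Set ι × Set ι) : Prop := q.1 ∆ τ ⊆ q'.1 ∆ τ ∧ q'.2 ∆ τ ⊆ q.2 ∆ τ

/-- The three NEGATIVE token conditions at a configuration: `N1 = [x₁∈𝒱][x₃∈𝒲]`, `N2 = [x₁∈𝒲][x₂∈𝒱]`, `N3 = [x₂∈𝒱∩𝒲]`. [this work] -/
def negCond (τ : Set ι) (𝒱 𝒲 : Set (Set ι)) (q : Set ι × Set ι) : Fin 3 → Prop :=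
  ![cp₁ τ q ∈ 𝒱 ∧ cp₃ τ q ∈ 𝒲, cp₁ τ q ∈ 𝒲 ∧ cp₂ τ q ∈ 𝒱, cp₂ τ q ∈ 𝒱 ∧ cp₂ τ q ∈ 𝒲]

/-- The three POSITIVE token conditions: units `a`, `b` at `[x₁∈𝒱∩𝒲]` and one token at `[x₂∈𝒱][x₃∈𝒲]`. [this work] -/
def posCond (τ : Set ι) (𝒱 𝒲 : Set (Set ι)) (q : Set ι × Set ι) : Fin 3 → Prop :=
  ![cp₁ τ q ∈ 𝒱 ∧ cp₁ τ q ∈ 𝒲, cp₁ τ q ∈ 𝒱 ∧ cp₁ τ q ∈ 𝒲, cp₂ τ q ∈ 𝒱 ∧ cp₃ τ q ∈ 𝒲]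

/-- The negative tokens: pairs (configuration, type). [this work] -/
def negToks (τ : Set ι) (𝒱 𝒲 : Set (Set ι)) : Finset ((Set ι × Set ι) × Fin 3) :=
  (cfgs ι ×ˢ univ).filter fun p => negCond τ 𝒱 𝒲 p.1 p.2

/-- The positive tokens. [this work] -/
def posToks (τ : Set ι) (𝒱 𝒲 : Set (Set ι)) : Finset ((Set ι × Set ι) × Fin 3) :=
  (cfgs ι ×ˢ univ).filter fun p => posCond τ 𝒱 𝒲 p.1 p.2

omit [Fintype ι] in
/-- The kernel is the number of positive tokens minus the number of negative tokens, configuration by configuration. [this work] -/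
theorem gtKernel_eq_tokens (τ : Set ι) (𝒱 𝒲 : Set (Set ι)) (q : Set ι × Set ι) :
    gtKernel τ 𝒱 𝒲 q
      = (∑ j : Fin 3, if posCond τ 𝒱 𝒲 q j then (1 : ℤ) else 0) - ∑ i : Fin 3, if negCond τ 𝒱 𝒲 q i then (1 : ℤ) else 0 := by
  rw [Fin.sum_univ_three, Fin.sum_univ_three]
  simp only [posCond, negCond, Matrix.cons_val_zero, Matrix.cons_val_one, Matrix.head_cons, Matrix.cons_val_two,
    Matrix.tail_cons]
  unfold gtKernel ind
  by_cases a : cp₁ τ q ∈ 𝒱 <;> by_cases b : cp₁ τ q ∈ 𝒲 <;> by_cases c : cp₂ τ q ∈ 𝒱 <;> by_cases d : cp₂ τ q ∈ 𝒲 <;>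
    by_cases e : cp₃ τ q ∈ 𝒲 <;> simp [a, b, c, d, e, Set.mem_inter_iff]

/-- Number of tokens at configurations in `𝒰`, as a double sum. [this work] -/
theorem card_toks_filter_eq_sum (R : Set ι × Set ι → Fin 3 → Prop) (𝒰 : Set (Set ι × Set ι)) :
    (#(((cfgs ι ×ˢ (univ : Finset (Fin 3))).filter fun p => R p.1 p.2).filter fun p => p.1 ∈ 𝒰) : ℤ)
      = ∑ q ∈ (cfgs ι).filter (fun q => q ∈ 𝒰), ∑ j : Fin 3, if R q j then (1 : ℤ) else 0 := by
  rw [filter_filter, natCast_card_filter, sum_product, sum_filter]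
  refine sum_congr rfl fun q _ => ?_
  by_cases hq : q ∈ 𝒰
  · simp only [hq, and_true, if_true]
  · simp [hq]

/-- **`∑_{q∈𝒰} κ = #(positive tokens in 𝒰) − #(negative tokens in 𝒰)`.** [this work] -/
theorem sum_gtKernel_eq_card_sub_card (τ : Set ι) (𝒱 𝒲 : Set (Set ι)) (𝒰 : Set (Set ι × Set ι)) :
    ∑ q ∈ (cfgs ι).filter (fun q => q ∈ 𝒰), gtKernel τ 𝒱 𝒲 q
      = (#((posToks τ 𝒱 𝒲).filter fun p => p.1 ∈ 𝒰) : ℤ) - #((negToks τ 𝒱 𝒲).filter fun p => p.1 ∈ 𝒰) := by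
  unfold posToks negToks
  rw [card_toks_filter_eq_sum, card_toks_filter_eq_sum, ← sum_sub_distrib]
  exact sum_congr rfl fun q _ => gtKernel_eq_tokens τ 𝒱 𝒲 q

/-! ## A monotone token matching proves the transport inequality -/

/-- **`GTMatchable τ 𝒱 𝒲`**: the negative tokens can be sent injectively to positive tokens at configurations above them in the grid order
(a token matching).  By Hall's theorem this is EQUIVALENT to `∑_{q∈𝒰} κ ≥ 0` for all up-closed `𝒰`; only the easy direction is used
here. [this work] -/
def GTMatchable (τ : Set ι) (𝒱 𝒲 : Set (Set ι)) : Prop :=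
  ∃ Φ : (Set ι × Set ι) × Fin 3 → (Set ι × Set ι) × Fin 3,
    (∀ t ∈ negToks τ 𝒱 𝒲, Φ t ∈ posToks τ 𝒱 𝒲 ∧ gle τ t.1 (Φ t).1) ∧ Set.InjOn Φ (negToks τ 𝒱 𝒲)

/-- **A token matching proves the grid-transport inequality** for every family `𝒰` closed upwards in the grid order. [this work] -/
theorem sum_gtKernel_nonneg_of_gtMatchable {τ : Set ι} {𝒱 𝒲 : Set (Set ι)} (h : GTMatchable τ 𝒱 𝒲)
    {𝒰 : Set (Set ι × Set ι)} (h𝒰 : ∀ q q' : Set ι × Set ι, q ∈ 𝒰 → q.1 ∆ τ ⊆ q'.1 ∆ τ → q'.2 ∆ τ ⊆ q.2 ∆ τ → q' ∈ 𝒰) :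
    0 ≤ ∑ q ∈ (cfgs ι).filter (fun q => q ∈ 𝒰), gtKernel τ 𝒱 𝒲 q := by
  obtain ⟨Φ, hΦ, hinj⟩ := h
  rw [sum_gtKernel_eq_card_sub_card, sub_nonneg, Nat.cast_le]
  refine card_le_card_of_injOn Φ (fun t ht => ?_) (fun t ht t' ht' htt' => ?_)
  · rw [mem_coe, mem_filter] at ht ⊢
    obtain ⟨hpos, hle⟩ := hΦ t ht.1
    exact ⟨hpos, h𝒰 t.1 (Φ t).1 ht.2 hle.1 hle.2⟩
  · rw [mem_coe, mem_filter] at ht ht'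
    exact hinj ht.1 ht'.1 htt'

/-- Hence **a token matching for every instance proves `GridTransport`** (and with it `ThreePartitionPositivityTwisted`, COMB-C3 and
Sahi's `C₃` for product measures, `…GridTransport`). [this work] -/
theorem gridTransport_of_gtMatchable
    (h : ∀ (ι : Type) [Fintype ι] (τ : Set ι) (𝒱 𝒲 : Set (Set ι)), IsUpperSet 𝒱 → IsUpperSet 𝒲 → GTMatchable τ 𝒱 𝒲) :
    GridTransport := by
  intro ι _ τ 𝒱 𝒲 𝒰 h𝒱 h𝒲 h𝒰
  exact sum_gtKernel_nonneg_of_gtMatchable (h ι τ 𝒱 𝒲 h𝒱 h𝒲) h𝒰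

/-! ## The typed fibre-local matching conjecture -/

/-- The TYPE DISCIPLINE of the fibre-local matching (memo §5/§5b): a negative token `(q,i)` may use the positive token `(q',j)` iff
`q ≤ q'` in the grid order AND: `N2 ↦` unit `b` with the same copy 3; `N3 ↦` unit `a` with the same copy 3, or the `[x₂∈𝒱][x₃∈𝒲]`-token with
the same copy 1; `N1 ↦` unit `a` with the same copy 2 (pure merge of part of copy 3 into copy 1), or unit `b` with copy 3 contained in its own.
[this work] -/
def typedEdge (τ : Set ι) (q : Set ι × Set ι) (i : Fin 3) (q' : Set ι × Set ι) (j : Fin 3) : Prop :=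
  gle τ q q' ∧
    ((i = 0 ∧ ((j = 0 ∧ cp₂ τ q' = cp₂ τ q) ∨ (j = 1 ∧ cp₃ τ q' ⊆ cp₃ τ q))) ∨
     (i = 1 ∧ j = 1 ∧ cp₃ τ q' = cp₃ τ q) ∨
     (i = 2 ∧ ((j = 0 ∧ cp₃ τ q' = cp₃ τ q) ∨ (j = 2 ∧ cp₁ τ q' = cp₁ τ q))))

/-- **`TypedMatchable τ 𝒱 𝒲`**: a token matching obeying the type discipline `typedEdge`. [this work] -/
def TypedMatchable (τ : Set ι) (𝒱 𝒲 : Set (Set ι)) : Prop :=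
  ∃ Φ : (Set ι × Set ι) × Fin 3 → (Set ι × Set ι) × Fin 3,
    (∀ t ∈ negToks τ 𝒱 𝒲, Φ t ∈ posToks τ 𝒱 𝒲 ∧ typedEdge τ t.1 t.2 (Φ t).1 (Φ t).2) ∧ Set.InjOn Φ (negToks τ 𝒱 𝒲)

/-- **CONJECTURE `TypedGridMatching`** (this work; OPEN): every instance admits a typed fibre-local token matching.  EVIDENCE (seat code
`gttyped*.c`): all `(τ,𝒱,𝒲)` on `≤ 3` points (`2 888` nontrivial instances); `4.7·10⁴` random instances on `4` points and `3·10³`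
on `5` points (untyped fibre-local form: all `446 224` instances on `4` points) — `0` failures.  Implies `GridTransport`.  An obligation /
hypothesis — never a fact. [this work] [status: open] -/
@[conjecture] def TypedGridMatching : Prop :=
  ∀ (ι : Type) [Fintype ι] (τ : Set ι) (𝒱 𝒲 : Set (Set ι)), IsUpperSet 𝒱 → IsUpperSet 𝒲 → TypedMatchable τ 𝒱 𝒲

/-- A typed matching is a matching. [this work] -/
theorem gtMatchable_of_typedMatchable {τ : Set ι} {𝒱 𝒲 : Set (Set ι)} (h : TypedMatchable τ 𝒱 𝒲) : GTMatchable τ 𝒱 𝒲 := by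
  obtain ⟨Φ, hΦ, hinj⟩ := h
  exact ⟨Φ, fun t ht => ⟨(hΦ t ht).1, (hΦ t ht).2.1⟩, hinj⟩

/-- **`TypedGridMatching` implies `GridTransport`** (hence twisted three-partition positivity, COMB-C3, Sahi's `C₃` for product
measures). [this work] [status: conditional on `TypedGridMatching`] -/
theorem gridTransport_of_typedGridMatching (h : TypedGridMatching) : GridTransport :=
  gridTransport_of_gtMatchable fun ι _ τ 𝒱 𝒲 h𝒱 h𝒲 => gtMatchable_of_typedMatchable (h ι τ 𝒱 𝒲 h𝒱 h𝒲)

/-- … and hence `ThreePartitionPositivityTwisted`. [this work] [status: conditional on `TypedGridMatching`] -/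
theorem threePartitionPositivityTwisted_of_typedGridMatching (h : TypedGridMatching) : ThreePartitionPositivityTwisted :=
  threePartitionPositivityTwisted_of_gridTransport (gridTransport_of_typedGridMatching h)

end Summit.CriticalPhenomena.PercolationContinuityZ3.Theorems.ThreePartition

end
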